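import Literature.Topology.FourManifolds.BordismFourProjectivePlane
import Literature.Topology.FourManifolds.LatticeFormsParity
import Literature.AlgebraicTopology.SingularHomology.CollapseMap
import Literature.AlgebraicTopology.SingularHomology.LocalDegreeSign
import HarnessLib

/-!
# A closed 4-manifold containing an open copy of `ℂℙ² ∖ {pt}` has an odd intersection form

Topic `Literature/Topology/FourManifolds` (barrier seat
`provefact-Literature.Barriers.SmoothPoincare4.Stab-ad8c696e34`, seat 0).  The homological half of
the statement that the *twisted* surgery `X # S² ×~ S² = X # ℂℙ² # \overline{ℂℙ²}` along a trivial
circle of a closed 4-manifold has an odd intersection form (R. C. Kirby, *The Topology of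
4-Manifolds*, LNM 1374 (1989), Ch. I §3 p. 10 and Ch. VIII p. 50: *"two framings … `S² × S²` or
`S² ×~ S²`"*; R. Gompf, A. Stipsicz, *4-Manifolds and Kirby Calculus* (1999), §1.2, Ex. 1.2.1 and
§5.2: `Q_{ℂℙ²} = ⟨1⟩`, `S² ×~ S² ≅ ℂℙ² # \overline{ℂℙ²}`, and the intersection form of a connected
sum is the orthogonal sum), isolated as a statement about an arbitrary closed topological
4-manifold `P` containing an open subset homeomorphic to the punctured projective plane:

> if `j : ℂℙ² ∖ {[0:0:1]} → P` is an open embedding into a closed topological 4-manifold `P`, the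
> intersection form of EVERY `ℤ`-orientation of `P` is odd.

Proof (A. Hatcher, *Algebraic Topology* (2002), §3.3 Exercise 7–8 and Prop. 3.38; the
degree-one collapse onto a summand, as in Kervaire–Milnor 1963, §2): the collapse `q : P → ℂℙ²` of the complement of the image of `j` to the point `[0:0:1]`
(`collapseMap`, `CollapseMap.lean`) is a local homeomorphism at the points of the image, so it
carries the fundamental class `[P]` to `±[ℂℙ²]` (`exists_units_map_fundamentalClass_collapseMap`:
the local classes at a point of the image and at its value are generators of `H₄(· | ·) ≅ ℤ`,
matched by the local isomorphism `isIso_map_collapseMap`, and `H₄(ℂℙ²) → H₄(ℂℙ² | y)` is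
injective, Hatcher Thm. 3.26(b)); a generator `h` of `H²(ℂℙ²; ℤ)/T ≅ ℤ` has `⟨h ⌣ h, [ℂℙ²]⟩ = ±1`
by the unimodularity of the cup pairing (Poincaré duality, Hatcher Prop. 3.38, PROVED in the tree:
`poincare_duality`, `isPerfPair_cupPairingModTorsion_of_poincareDuality`;
`ComplexProjectivePlane.exists_cupPairing_self_eq_units`), and then
`⟨q^*h ⌣ q^*h, [P]⟩ = ⟨h ⌣ h, q_*[P]⟩ = ±1` is odd
(`isOdd_intersectionForm_of_isOpenEmbedding_puncturedProjectivePlane`).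

Everything here is PROVED; no definition of a notion, no named fact.  Consumer: the oddness
`hodd` of the twisted level passage in the parity route to `StableBarrierFour`
(`Literature/Barriers/SmoothPoincare4/StableInvariantsBlindParity.lean`), via an explicit open
embedding of the punctured projective plane into the twisted surgery (sibling file).

## References

* R. C. Kirby, *The Topology of 4-Manifolds*, LNM 1374 (1989), Ch. I §3 p. 10, Ch. VIII p. 50.
  [Kirby1989]
* R. E. Gompf, A. I. Stipsicz, *4-Manifolds and Kirby Calculus*, GSM 20 (1999), §1.2
  (Ex. 1.2.1: `Q_{ℂℙ²} = ⟨1⟩`; intersection form of a connected sum), §5.2. [GompfStipsicz1999]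
* A. Hatcher, *Algebraic Topology*, CUP 2002, §3.3: Thm. 3.26, Exercise 7, Prop. 3.38, Cor. 3.39.
  [HatcherAT2002]
-/

noncomputable section

open CategoryTheory Set Function Topology
open Literature.AlgebraicTopology.SingularHomology

universe u

/-! ### The collapse map of an open subset onto a closed oriented manifold has degree `±1` -/

namespace Literature.AlgebraicTopology.SingularHomology


/-- **The collapse map onto a closed connected oriented manifold has degree `±1`.**  Let `X`, `Y`
be closed topological `n`-manifolds, `Y` connected, with `ℤ`-orientations `μX`, `μY`; let
`U ⊆ X` be open, `p ∈ Y`, and `g : U ≃ₜ Y ∖ {p}`.  Then the collapse map `q : X → Y` (`g` on `U`,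
`p` off `U`) satisfies `q_*[X] = ±[Y]`: at a point `x₀ ∈ U` the local classes `μX_{x₀}`,
`μY_{q x₀}` generate `Hₙ(X | x₀) ≅ ℤ ≅ Hₙ(Y | q x₀)`, `q` is an isomorphism on local homology there
(`isIso_map_collapseMap`), so `q_*[X]` and `±[Y]` have the same image in `Hₙ(Y | q x₀)`, into
which `Hₙ(Y)` injects (Hatcher Thm. 3.26(b)). [cite: HatcherAT2002, §3.3 Exercise 7 and Thm. 3.26] -/
theorem exists_units_map_fundamentalClass_collapseMap {n : ℕ} {X Y : Type u} [TopologicalSpace X]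
    [TopologicalSpace Y] [T2Space X] [CompactSpace X] [ChartedSpace (EuclideanSpace ℝ (Fin n)) X]
    [T2Space Y] [CompactSpace Y] [ChartedSpace (EuclideanSpace ℝ (Fin n)) Y] [ConnectedSpace Y]
    (μX : HomologicalOrientation ℤ X n) (μY : HomologicalOrientation ℤ Y n) {U : Set X}
    (hU : IsOpen U) (p : Y)
    (g : U ≃ₜ (({p}ᶜ : Set Y))) (hUne : U.Nonempty) :
    ∃ u : ℤˣ, singularHomology.map ℤ ℤ (collapseMap hU p g) n μX.fundamentalClass =
      (u : ℤ) • μY.fundamentalClass := by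
  obtain ⟨x₀, hx₀⟩ := hUne
  have hcX := HomologicalOrientation.isFundamentalClass_fundamentalClass_holds n μX
  have hcY := HomologicalOrientation.isFundamentalClass_fundamentalClass_holds n μY
  set q := collapseMap hU p g with hq
  set y₀ : Y := (g ⟨x₀, hx₀⟩ : Y) with hy₀
  -- the local isomorphism at `x₀`
  haveI := isIso_map_collapseMap ℤ ℤ hU p g hx₀ n
  set φ := (asIso (relativeSingularHomology.map ℤ ℤ q (mapsTo_collapseMap hU p g hx₀) n)).toLinearEquiv
    with hφ
  -- it carries the generator `μX_{x₀}` to `± μY_{y₀}`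
  obtain ⟨u, hu⟩ := exists_units_smul_eq_of_linearEquiv φ (μX.isGenerator x₀) (μY.isGenerator y₀)
  refine ⟨u, ?_⟩
  -- naturality of the localisation
  have hsq := relativeSingularHomology.ofAbsolute_comp_map ℤ ℤ q (mapsTo_collapseMap hU p g hx₀) n
  have h1 : singularHomology.toLocal ℤ ℤ y₀ n (singularHomology.map ℤ ℤ q n μX.fundamentalClass) =
      (u : ℤ) • μY.localClass y₀ := by
    have h := congrArg (fun F => F μX.fundamentalClass) hsq
    simp only [ModuleCat.comp_apply] at h
    change relativeSingularHomology.ofAbsolute ℤ ℤ Y {y₀}ᶜ n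
      (singularHomology.map ℤ ℤ q n μX.fundamentalClass) = _
    rw [← h]
    change φ (singularHomology.toLocal ℤ ℤ x₀ n μX.fundamentalClass) = _
    rw [hcX x₀, hu]
  apply singularHomology.toLocal_injective_of_connectedSpace_holds ℤ ℤ Y n y₀
  rw [h1, map_zsmul, hcY y₀]

end Literature.AlgebraicTopology.SingularHomology

namespace Literature.Topology.FourManifolds

open Literature.AlgebraicTopology.SingularHomology ComplexProjectiveSpace

/-! ### `ℂℙ²` has a class of square `±1` -/

/-- **A rank-one unimodular lattice represents `±1`**: if a bilinear form `Q` on a `ℤ`-module `F`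
with `F ≃ ℤ` is a perfect pairing, then `Q g g = ±1` for the generator `g`.
[cite: MilnorHusemoller1973, §I.3] -/
theorem exists_apply_self_eq_units_of_isPerfPair_of_linearEquiv_int {F : Type*} [AddCommGroup F]
    [Module ℤ F] (Q : LinearMap.BilinForm ℤ F) (hQ : Q.IsPerfPair) (e : F ≃ₗ[ℤ] ℤ) :
    ∃ u : ℤˣ, Q (e.symm 1) (e.symm 1) = (u : ℤ) := by
  set g := e.symm 1 with hg
  have heg : e g = 1 := by rw [hg, LinearEquiv.apply_symm_apply]
  -- every element is a multiple of `g`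
  have hmul : ∀ y : F, y = (e y) • g := fun y => by
    apply e.injective
    rw [map_zsmul, heg, smul_eq_mul, mul_one]
  -- the functional `e` is `Q y` for some `y = m • g`
  obtain ⟨y, hy⟩ := (LinearMap.IsPerfPair.bijective_left Q).2 e.toLinearMap
  have h1 : Q y g = 1 := by
    rw [hy]
    exact heg
  rw [hmul y, map_zsmul, LinearMap.smul_apply, smul_eq_mul] at h1
  obtain ⟨u, hu⟩ := IsUnit.of_mul_eq_one_right (e y) h1
  exact ⟨u, hu.symm⟩

/-- **`ℂℙ²` carries an integral class of square `±1`**: for every `ℤ`-orientation `μ` of `ℂℙ²`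
there is `h ∈ H²(ℂℙ²; ℤ)` with `⟨h ⌣ h, [ℂℙ²]_μ⟩ = ±1` (Gompf–Stipsicz 1999, Ex. 1.2.1:
`Q_{ℂℙ²} = ⟨1⟩`; here from `H²(ℂℙ²; ℤ)/T ≅ ℤ`, `ComplexProjectivePlane.freeCohomologyTwoLinearEquivInt`,
and the unimodularity of the cup pairing, Poincaré duality Hatcher Prop. 3.38 / Cor. 3.39, proved
in the tree as `poincare_duality`). [cite: GompfStipsicz1999, §1.2 Ex. 1.2.1] [cite: HatcherAT2002, §3.3 Prop. 3.38 and Cor. 3.39] -/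
theorem ComplexProjectivePlane.exists_cupPairing_self_eq_units
    (μ : HomologicalOrientation ℤ ComplexProjectivePlane 4) :
    ∃ (h : singularCohomology ℤ ℤ ComplexProjectivePlane 2) (u : ℤˣ),
      cupPairing μ two_add_two_eq_four h h = (u : ℤ) := by
  -- unimodularity of the cup pairing modulo torsion
  have hF : finite_singularCohomology_of_compactSpace ℤ ComplexProjectivePlane 4 2 :=
    finite_singularCohomology_of_compactSpace_of_isPrincipalIdealRing ℤ ComplexProjectivePlane 4 2
  have hK : LinearMap.ker (kroneckerPairing ℤ ℤ ComplexProjectivePlane 2) ≤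
      Submodule.torsion ℤ (singularCohomology ℤ ℤ ComplexProjectivePlane 2) := by
    rw [LinearMap.ker_eq_bot.2 (kroneckerPairing_bijective_of_isZero ℤ ComplexProjectivePlane 1
      (ComplexProjectivePlane.isZero_singularHomology_one ℤ ℤ)).1]
    exact bot_le
  have hP : isPerfPair_cupPairingModTorsion μ two_add_two_eq_four :=
    isPerfPair_cupPairingModTorsion_of_poincareDuality μ _ (poincare_duality μ two_add_two_eq_four)
      (kroneckerMap_surjective_holds ℤ ComplexProjectivePlane 2) hK hF
  obtain ⟨u, hu⟩ := exists_apply_self_eq_units_of_isPerfPair_of_linearEquiv_int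
    (intersectionForm two_add_two_eq_four μ) hP ComplexProjectivePlane.freeCohomologyTwoLinearEquivInt
  obtain ⟨h, hh⟩ := freeCohomology.mk_surjective
    (ComplexProjectivePlane.freeCohomologyTwoLinearEquivInt.symm 1 : freeCohomology ℤ ComplexProjectivePlane 2)
  refine ⟨h, u, ?_⟩
  rw [← intersectionForm_mk_mk two_add_two_eq_four μ, hh, hu]

/-! ### Open copies of the punctured projective plane force an odd intersection form -/

/-- **A closed 4-manifold containing an open copy of `ℂℙ² ∖ {pt}` has an odd intersection form**
(the homological content of "`X # ℂℙ² # \overline{ℂℙ²}` — in particular the twisted surgery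
`X # S² ×~ S²` — is odd", Kirby 1989 Ch. I §3, Gompf–Stipsicz 1999 §1.2 and §5.2).  For a closed
topological 4-manifold `P : Type`, an open embedding `j : ℂℙ² ∖ {[0:0:1]} → P` and ANY
`ℤ`-orientation `μ` of `P`: with `q : P → ℂℙ²` the collapse of the complement of the image of
`j` (degree `±1`, `exists_units_map_fundamentalClass_collapseMap`) and `h ∈ H²(ℂℙ²; ℤ)` of
square `±1` (`ComplexProjectivePlane.exists_cupPairing_self_eq_units`),
`⟨q^*h ⌣ q^*h, [P]⟩ = ⟨h ⌣ h, q_*[P]⟩ = ±1`, so the class of `q^*h` in `H²(P; ℤ)/T` has odd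
square. [cite: GompfStipsicz1999, §1.2 and §5.2] [cite: Kirby1989, Ch. I §3 p. 10] [cite: HatcherAT2002, §3.3 Exercise 7] -/
theorem isOdd_intersectionForm_of_isOpenEmbedding_puncturedProjectivePlane {P : Type}
    [TopologicalSpace P] [T2Space P] [CompactSpace P] [ChartedSpace (EuclideanSpace ℝ (Fin 4)) P]
    (j : ↥(({center (n := 1) 2}ᶜ : Set ComplexProjectivePlane)) → P) (hj : IsOpenEmbedding j)
    (μ : HomologicalOrientation ℤ P 4) :
    (intersectionForm two_add_two_eq_four μ).IsOdd := by
  -- the collapse map onto `ℂℙ²`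
  set U : Set P := range j with hUdef
  have hU : IsOpen U := hj.isOpen_range
  set g : U ≃ₜ (({center (n := 1) 2}ᶜ : Set ComplexProjectivePlane)) :=
    (hj.isEmbedding.toHomeomorph).symm with hg
  have hUne : U.Nonempty := by
    obtain ⟨x⟩ : Nonempty (({center (n := 1) 2}ᶜ : Set ComplexProjectivePlane)) := by
      refine ⟨⟨ComplexProjectivePlane.chartEmb (EuclideanSpace.single 0 1), ?_⟩⟩
      rw [mem_compl_iff, mem_singleton_iff, ← ComplexProjectivePlane.chartEmb_zero]
      intro h
      have := ComplexProjectivePlane.isOpenEmbedding_chartEmb.injective h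
      simpa using congrArg (fun v : EuclideanSpace ℝ (Fin (3 + 1)) => v 0) this
    exact ⟨j x, mem_range_self x⟩
  obtain ⟨μC⟩ : Nonempty (HomologicalOrientation ℤ ComplexProjectivePlane 4) :=
    isOrientableOver_int_of_simplyConnectedSpace_holds ComplexProjectivePlane (n := 4)
  set q := collapseMap hU (center (n := 1) 2) g with hq
  obtain ⟨u, hu⟩ := exists_units_map_fundamentalClass_collapseMap μ μC hU (center (n := 1) 2) g hUne
  obtain ⟨h, v, hv⟩ := ComplexProjectivePlane.exists_cupPairing_self_eq_units μC
  -- the pulled-back class has square `±1`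
  rw [LinearMap.BilinForm.isOdd_iff]
  refine ⟨freeCohomology.mk (singularCohomology.map ℤ ℤ q 2 h), ?_⟩
  rw [intersectionForm_mk_mk, cupPairing_apply, ← cupProduct_map, kroneckerPairing_map, hu,
    map_zsmul, ← cupPairing_apply, hv, smul_eq_mul]
  exact (Int.isUnit_iff.1 (u.isUnit.mul v.isUnit)).elim (fun h1 => by rw [h1]; exact odd_one)
    fun h1 => by rw [h1]; exact odd_neg_one

end Literature.Topology.FourManifolds

end
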